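import Literature.Probability.RandomPlanarGeometry.HexSAWPolygonCellsCorners
import Literature.Probability.RandomPlanarGeometry.SAWPolygonPathSurgery
import HarnessLib

/-!
# Cell calculus for honeycomb polygon surgery, XIX: adding or removing a hexagon along a contiguous contact arc keeps the boundary a POLYGON

Topic `Literature/Probability/RandomPlanarGeometry` (lane «pcv-sawmu», a-p4 g22; sequel of `HexSAWPolygonCellsBoundary.lean` (XVII: `bdry`),
`HexSAWPolygonCellsCorners.lean` (XVIII: corners, `arcWalk`, `cells_at_corner`) and the tree's `SAWPolygonPathSurgery.lean` (`IsPolygon.reroute`)).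

Third module of the BRIDGE between the cell layer of «OMEGA» (`HOME/pub-sawmu-a-p4/g21/omega/THEOREM-OMEGA-g21.md`) and the tree's bond-set polygons
`IsPolygon brickWallGraph E` (`SupercriticalSAWPolygons`): the (L1-moves) item of the Lean plan.  Say `S` is a finite set of bricks whose boundary
`bdry S` is a polygon (the bond set of a cycle of the brick wall).

* ★ `isPolygon_bdry_insert` — if `c ∉ S` and the hexagons of `S` adjacent to `c` are exactly `nbrDir c a, …, nbrDir c (a+m−1)` for some
  `1 ≤ m ≤ 4` (a contiguous arc of contacts; `m < perim S`), then `bdry (insert c S)` is again a polygon: by `bdry_insert` it is `bdry S` with the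
  contact arc `corner c a → ⋯ → corner c (a+m)` replaced by the complementary arc of the hexagon, whose interior corners carry no bond of `bdry S`
  (`cells_at_corner`), so `IsPolygon.reroute` applies.  The cases `m = 1` (a new leaf, `+4`), `m = 2` (`+2`: the flip, the last roof hexagon, …),
  `m = 3` (`±0`: inner roof hexagons) and `m = 4` (`−2`) are exactly the insertions used by «OMEGA».
* ★ `isPolygon_bdry_erase` — removing a hexagon `c ∈ S` with a single contact (`perim S ≥ 7`) keeps the boundary a polygon (the five free bonds are
  replaced by the contact bond; `isPolygon_sdiff_insert_edge`, the one-bond variant of `IsPolygon.reroute`) — the peeling of up-right spikes.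
* `bdry_erase` — the bond-set form of `perim_erase`.

Sources: N. Madras, G. Slade, *The Self-Avoiding Walk* (1993), §3.2, proof of Theorem 3.2.3 pp. 64–65 (the surgery replaces the bonds of the polygon on a
unit square by the remaining bonds of that square; the result "is clearly a polygon") [MadrasSlade1993]; A. Hammond, arXiv:1504.05286v5, Definition 4.3
p. 20 (`τ_mod`: the same local modification on a plaquette) [Hammond2015SAPJoining]; I. G. Enting, I. Jensen, LNP 775 (2009) §7.4.2 [EntingJensen2009].
Label (lane): LANE INFRASTRUCTURE; nothing new in writing.
-/

open Finset Literature.Probability.LatticeModels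

namespace Literature.Probability.RandomPlanarGeometry.SAW

namespace HexCell

/-! ### Closing an opened polygon by one bond -/

/-- One-bond rerouting: if the edges of a self-avoiding path `p : a ⇝ b` with `0 < |p| ≤ #E − 2` lie in the polygon `E` and `a – b` is a bond, then
`(E ∖ edges p) ∪ {a–b}` is a polygon with `#E − |p| + 1` bonds (the variant of `IsPolygon.reroute` with a new path of length one).
[cite: MadrasSlade1993, §3.2 (proof of Theorem 3.2.3, pp. 64–65: replacing bonds of a polygon on a unit cell)] -/
theorem isPolygon_sdiff_insert_edge {V : Type*} [DecidableEq V] {G : SimpleGraph V} {E : Finset (Sym2 V)} (hE : IsPolygon G E)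
    {a b : V} {p : G.Walk a b} (hp : p.IsPath) (hpE : ∀ e ∈ p.edges, e ∈ E) (h0 : 0 < p.length) (h2 : p.length + 2 ≤ #E)
    (hab : G.Adj a b) :
    IsPolygon G (insert s(a, b) (E \ p.edges.toFinset)) ∧ #(insert s(a, b) (E \ p.edges.toFinset)) + p.length = #E + 1 := by
  obtain ⟨q, hq, hqe, hql, -⟩ := hE.exists_isPath_sdiff p hp hpE h0 (by omega)
  have hrp : (SimpleGraph.Walk.cons hab.symm SimpleGraph.Walk.nil : G.Walk b a).IsPath := by
    rw [SimpleGraph.Walk.cons_isPath_iff]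
    exact ⟨SimpleGraph.Walk.IsPath.nil, by simp [hab.ne.symm]⟩
  have hcyc : (q.append (SimpleGraph.Walk.cons hab.symm SimpleGraph.Walk.nil)).IsCycle := by
    refine hq.isCycle_append hrp ?_ (Or.inl (by omega))
    intro x hx hx'
    simp only [SimpleGraph.Walk.support_cons, SimpleGraph.Walk.support_nil, List.tail_cons, List.mem_singleton] at hx'
    subst hx'
    have hnd := (SimpleGraph.Walk.isPath_def _).1 hq
    rw [← SimpleGraph.Walk.cons_tail_support] at hnd
    exact (List.nodup_cons.1 hnd).1 hx
  have hedges : (q.append (SimpleGraph.Walk.cons hab.symm SimpleGraph.Walk.nil)).edges.toFinset = insert s(a, b) (E \ p.edges.toFinset) := by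
    rw [SimpleGraph.Walk.edges_append, List.toFinset_append, hqe, SimpleGraph.Walk.edges_cons, SimpleGraph.Walk.edges_nil,
      List.toFinset_cons, List.toFinset_nil, insert_empty_eq, Sym2.eq_swap, union_comm, ← insert_eq]
  refine ⟨⟨a, _, hcyc, hedges⟩, ?_⟩
  rw [← hedges, List.toFinset_card_of_nodup hcyc.edges_nodup, SimpleGraph.Walk.length_edges, SimpleGraph.Walk.length_append,
    SimpleGraph.Walk.length_cons, SimpleGraph.Walk.length_nil]
  omega

/-! ### The contacts and the free neighbours along an arc -/

/-- If the hexagons of `S` adjacent to `c` are exactly the directions `a, …, a+m−1` (`m ≤ 6`), the contact set is that arc.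
[cite: MadrasSlade1993, §3.2 (proof of Theorem 3.2.3)] -/
theorem nbrs_inter_eq_image_of_arc {S : Finset Cell} {c : Cell} {a m : ℕ} (hm : m ≤ 6) (harc : ∀ i < 6, nbrDir c (a + i) ∈ S ↔ i < m) :
    nbrs c ∩ S = (range m).image fun j => nbrDir c (a + j) := by
  ext d
  rw [mem_inter, mem_image]
  constructor
  · rintro ⟨hd, hdS⟩
    obtain ⟨i, hi, rfl⟩ := (mem_nbrs_iff_exists_nbrDir a).1 hd
    exact ⟨i, mem_range.2 ((harc i hi).1 hdS), rfl⟩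
  · rintro ⟨j, hj, rfl⟩
    rw [mem_range] at hj
    exact ⟨nbrDir_mem_nbrs c _, (harc j (by omega)).2 hj⟩

/-- … and the free neighbours are the complementary arc `a+m, …, a+5`. [cite: MadrasSlade1993, §3.2 (proof of Theorem 3.2.3)] -/
theorem nbrs_sdiff_eq_image_of_arc {S : Finset Cell} {c : Cell} {a m : ℕ} (hm : m ≤ 6) (harc : ∀ i < 6, nbrDir c (a + i) ∈ S ↔ i < m) :
    nbrs c \ S = (range (6 - m)).image fun j => nbrDir c (a + m + j) := by
  ext d
  rw [mem_sdiff, mem_image]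
  constructor
  · rintro ⟨hd, hdS⟩
    obtain ⟨i, hi, rfl⟩ := (mem_nbrs_iff_exists_nbrDir a).1 hd
    have him : ¬ i < m := fun h => hdS ((harc i hi).2 h)
    exact ⟨i - m, mem_range.2 (by omega), by rw [show a + m + (i - m) = a + i by omega]⟩
  · rintro ⟨j, hj, rfl⟩
    rw [mem_range] at hj
    refine ⟨nbrDir_mem_nbrs c _, fun hdS => ?_⟩
    have := (harc (m + j) (by omega)).1 (by rw [show a + (m + j) = a + m + j by omega]; exact hdS)
    omega

/-! ### Adding a hexagon along a contiguous contact arc -/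

/-- ★ **Adding a hexagon with a contiguous arc of `m ∈ {1, 2, 3, 4}` contacts keeps the boundary a polygon.**
[cite: MadrasSlade1993, §3.2, proof of Theorem 3.2.3 pp. 64–65 (the modified set of bonds "is clearly a polygon")]
[cite: Hammond2015SAPJoining, Definition 4.3 p. 20 (arXiv v5: `τ_mod`)] -/
theorem isPolygon_bdry_insert {S : Finset Cell} {c : Cell} (hS : IsBrickSet S) (hc : Even (c.1 + c.2)) (hcS : c ∉ S)
    (hP : IsPolygon brickWallGraph (bdry S)) {a m : ℕ} (hm1 : 1 ≤ m) (hm4 : m ≤ 4) (hlt : m < perim S)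
    (harc : ∀ i < 6, nbrDir c (a + i) ∈ S ↔ i < m) :
    IsPolygon brickWallGraph (bdry (insert c S)) := by
  classical
  have hend : corner c (a + m + (6 - m)) = corner c a := corner_eq_of_mod_eq c (by omega)
  -- the contact arc `p : corner a ⇝ corner (a+m)` and the free arc `R` (same endpoints)
  have hpP : (arcWalk hc a m).IsPath := isPath_arcWalk hc a (by omega)
  have hRP : (((arcWalk hc (a + m) (6 - m)).copy rfl hend).reverse).IsPath :=
    ((SimpleGraph.Walk.isPath_copy _ _ _).2 (isPath_arcWalk hc (a + m) (by omega))).reverse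
  have hpE : ∀ e ∈ (arcWalk hc a m).edges, e ∈ bdry S := by
    intro e he
    obtain ⟨j, hj, rfl⟩ := (mem_edges_arcWalk hc).1 he
    rw [bond_comm]
    exact bond_mem_bdry ((harc j (by omega)).2 hj) (self_mem_nbrs_nbrDir c _) hcS
  have h0 : 0 < (arcWalk hc a m).length := by rw [length_arcWalk]; omega
  have hlt' : (arcWalk hc a m).length < #(bdry S) := by rw [length_arcWalk, card_bdry hS]; exact hlt
  have h2 : 2 ≤ (((arcWalk hc (a + m) (6 - m)).copy rfl hend).reverse).length := by
    rw [SimpleGraph.Walk.length_reverse, SimpleGraph.Walk.length_copy, length_arcWalk]; omega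
  have hRE : ∀ x ∈ (((arcWalk hc (a + m) (6 - m)).copy rfl hend).reverse).support,
      (∃ e ∈ bdry S, x ∈ e) → x = corner c a ∨ x = corner c (a + m) := by
    rintro x hx ⟨e, he, hxe⟩
    rw [SimpleGraph.Walk.support_reverse, List.mem_reverse, SimpleGraph.Walk.support_copy, mem_support_arcWalk hc] at hx
    obtain ⟨j, hj, rfl⟩ := hx
    rcases Nat.eq_zero_or_pos j with rfl | hj0
    · exact Or.inr rfl
    rcases eq_or_lt_of_le hj with rfl | hjlt
    · exact Or.inl hend
    exfalso
    obtain ⟨u, hu, w, hw, -, rfl⟩ := mem_bdry_iff.1 he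
    rcases cells_at_corner hc (hS u hu) hw hxe with rfl | rfl | rfl
    · exact hcS hu
    · have key := (harc ((m + j + 5) % 6) (Nat.mod_lt _ (by norm_num))).1
        (by rw [← nbrDir_eq_of_mod_eq c (show (a + m + j + 5) % 6 = (a + (m + j + 5) % 6) % 6 by omega)]; exact hu)
      omega
    · have key := (harc (m + j) (by omega)).1 (by rw [show a + (m + j) = a + m + j by omega]; exact hu)
      omega
  obtain ⟨hpoly, -⟩ := hP.reroute hpP hpE h0 hlt' hRP h2 hRE
  -- identify the rerouted bond set with `bdry (insert c S)`
  have hcontacts : (nbrs c ∩ S).image (bond c) = (arcWalk hc a m).edges.toFinset := by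
    rw [nbrs_inter_eq_image_of_arc (by omega) harc, image_image, edges_arcWalk_toFinset]; rfl
  have hfree : (nbrs c \ S).image (bond c) = (((arcWalk hc (a + m) (6 - m)).copy rfl hend).reverse).edges.toFinset := by
    rw [SimpleGraph.Walk.edges_reverse, List.toFinset_reverse, SimpleGraph.Walk.edges_copy, nbrs_sdiff_eq_image_of_arc (by omega) harc,
      image_image, edges_arcWalk_toFinset]; rfl
  rw [bdry_insert hS hc hcS, hcontacts, hfree]
  exact hpoly

/-! ### Removing a hexagon with a single contact -/

/-- Removing a hexagon: the bonds towards its free neighbours leave the boundary, the bonds towards its contacts enter it (the bond-set form of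
`perim_erase`). [cite: MadrasSlade1993, §3.2 (proof of Theorem 3.2.3)] -/
theorem bdry_erase {S : Finset Cell} {c : Cell} (hS : IsBrickSet S) (hcS : c ∈ S) :
    bdry (S.erase c) = bdry S \ (nbrs c \ S).image (bond c) ∪ (nbrs c ∩ S).image (bond c) := by
  have hc : Even (c.1 + c.2) := hS c hcS
  have hT : IsBrickSet (S.erase c) := fun d hd => hS d (mem_of_mem_erase hd)
  have hcT : c ∉ S.erase c := notMem_erase c S
  have hins := bdry_insert hT hc hcT
  rw [insert_erase hcS] at hins
  have hi : nbrs c ∩ S.erase c = nbrs c ∩ S := by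
    ext d; simp only [mem_inter, mem_erase]
    exact ⟨fun ⟨h1, _, h2⟩ => ⟨h1, h2⟩, fun ⟨h1, h2⟩ => ⟨h1, fun e => self_notMem_nbrs c (e ▸ h1), h2⟩⟩
  have hd : nbrs c \ S.erase c = nbrs c \ S := by
    ext d; simp only [mem_sdiff, mem_erase, not_and]
    constructor
    · rintro ⟨h1, h2⟩; exact ⟨h1, h2 (fun e => self_notMem_nbrs c (e ▸ h1))⟩
    · rintro ⟨h1, h2⟩; exact ⟨h1, fun _ => h2⟩
  rw [hi, hd] at hins
  -- `P ⊆ bdry T`, `Q ∩ bdry T = ∅`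
  have hP : ∀ e ∈ (nbrs c ∩ S).image (bond c), e ∈ bdry (S.erase c) := by
    intro e he
    obtain ⟨d, hd', rfl⟩ := mem_image.1 he
    obtain ⟨hdn, hdS⟩ := mem_inter.1 hd'
    rw [bond_comm]
    exact bond_mem_bdry (mem_erase.2 ⟨fun e => self_notMem_nbrs c (e ▸ hdn), hdS⟩) (mem_nbrs_comm.1 hdn) hcT
  have hQ : ∀ e ∈ (nbrs c \ S).image (bond c), e ∉ bdry (S.erase c) := by
    intro e he heT
    obtain ⟨d, hd', rfl⟩ := mem_image.1 he
    obtain ⟨hdn, hdS⟩ := mem_sdiff.1 hd'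
    obtain ⟨u, hu, w, hw, -, h⟩ := mem_bdry_iff.1 heT
    rcases cells_of_bond_eq (hT u hu) hc hw hdn h with ⟨e1, -⟩ | ⟨e1, -⟩
    · exact hcT (e1 ▸ hu)
    · exact hdS (mem_of_mem_erase (e1 ▸ hu))
  ext e
  rw [mem_union, mem_sdiff]
  constructor
  · intro heT
    by_cases heP : e ∈ (nbrs c ∩ S).image (bond c)
    · exact Or.inr heP
    · refine Or.inl ⟨?_, fun heQ => hQ e heQ heT⟩
      rw [hins, mem_union, mem_sdiff]
      exact Or.inl ⟨heT, heP⟩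
  · rintro (⟨heS, heQ⟩ | heP)
    · rw [hins, mem_union, mem_sdiff] at heS
      rcases heS with ⟨heT, -⟩ | heQ'
      · exact heT
      · exact absurd heQ' heQ
    · exact hP e heP

/-- ★ **Removing a hexagon with a single contact keeps the boundary a polygon** (`perim S ≥ 7`): the free arc of five bonds is replaced by the contact
bond. [cite: MadrasSlade1993, §3.2, proof of Theorem 3.2.3 pp. 64–65] -/
theorem isPolygon_bdry_erase {S : Finset Cell} {c : Cell} (hS : IsBrickSet S) (hcS : c ∈ S) (hP : IsPolygon brickWallGraph (bdry S))
    (h7 : 7 ≤ perim S) {a : ℕ} (harc : ∀ i < 6, nbrDir c (a + i) ∈ S ↔ i < 1) :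
    IsPolygon brickWallGraph (bdry (S.erase c)) := by
  classical
  have hc : Even (c.1 + c.2) := hS c hcS
  -- the free arc: five bonds from `corner (a+1)` round to `corner (a+6) = corner a`
  have hpP : (arcWalk hc (a + 1) 5).IsPath := isPath_arcWalk hc _ le_rfl
  have hpE : ∀ e ∈ (arcWalk hc (a + 1) 5).edges, e ∈ bdry S := by
    intro e he
    obtain ⟨j, hj, rfl⟩ := (mem_edges_arcWalk hc).1 he
    refine bond_mem_bdry hcS (nbrDir_mem_nbrs c _) fun hdS => ?_
    have := (harc (1 + j) (by omega)).1 (by rw [show a + (1 + j) = a + 1 + j by omega]; exact hdS)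
    omega
  have h0 : 0 < (arcWalk hc (a + 1) 5).length := by rw [length_arcWalk]; omega
  have h2 : (arcWalk hc (a + 1) 5).length + 2 ≤ #(bdry S) := by rw [length_arcWalk, card_bdry hS]; omega
  have hend : corner c (a + 1 + 5) = corner c a := corner_eq_of_mod_eq c (by omega)
  have hab : brickWallGraph.Adj (corner c (a + 1)) (corner c (a + 1 + 5)) := by
    rw [hend]; exact (adj_corner_succ hc a).symm
  obtain ⟨hpoly, -⟩ := isPolygon_sdiff_insert_edge hP hpP hpE h0 h2 hab
  have hfree : (nbrs c \ S).image (bond c) = (arcWalk hc (a + 1) 5).edges.toFinset := by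
    rw [nbrs_sdiff_eq_image_of_arc (by omega) harc, image_image, edges_arcWalk_toFinset]; rfl
  have hcontact : (nbrs c ∩ S).image (bond c) = {s(corner c (a + 1), corner c (a + 1 + 5))} := by
    rw [nbrs_inter_eq_image_of_arc (by omega) harc, image_image, range_one, image_singleton, Function.comp_apply, Nat.add_zero,
      bond_nbrDir, hend, Sym2.eq_swap]
  rw [bdry_erase hS hcS, hfree, hcontact, union_comm, ← insert_eq]
  exact hpoly

end HexCell

end Literature.Probability.RandomPlanarGeometry.SAW
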